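import Summits.CriticalPhenomena.CardyFormulaZ2.Theses.CardyIKTransport

/-!
# `CornerLineDescent` (route `CardyIKTransport`, stmt-CriticalPhenomena-10964): the corner-fugacity
# line has no monotone structure — 3-wise independence, negative association on `[0,1)`, no
# stochastic order in `t`

Negative-side support for the crux `CornerLineDescent` (cdisprove unit, cycle 1): one-face algebra
of the free corner-fugacity weight `t^{[odd face]}` on the four cells `(SW, SE, NW, NE)` around a grid
vertex.  With `p = t/(1+t)` this is EXACTLY the law of the four colours
`blk ω f, blk ω (f+e₀), blk ω (f+e₁), blk ω (f+1)` of the route's inline i.i.d. gauge (three of them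
i.i.d. fair, the fourth fixed by the Bernoulli(`p`) plaquette parity), i.e. the 2×2 marginal of
`M(t,½)` for every `t ≥ 0`; the isotropic IK point is `t = √3/2`, the freezing point `t = 0`, the
i.i.d. colouring `t = 1`.  Results (finite algebra over the 16 colourings, all sorry-free):

* `cornerFace_three_cells_uniform` — any three of the four cells are i.i.d. fair for EVERY `t`
  (3-wise independence: pairwise and three-point statistics of the colour field do not see `t`);
* `cornerFace_negative_association`, `cornerFace_cov_formula` — the increasing events
  `{SW ∨ NE black}` and `{SE ∧ NW black}` have `Cov = −(1−t)/(16(1+t)) < 0` for `0 ≤ t < 1`: no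
  Harris–FKG inequality anywhere on `[0,1)`, so FKG-based RSW gluing and Grimmett–Manolescu
  box-crossing transport do not apply verbatim;
* `cornerFace_no_stochastic_order` — for `0 ≤ t < t'` the increasing event `{≥ 3 black}` is more
  likely at `t'` and the increasing event `{4 black}` less likely: the family `M(t,½)` is not
  stochastically ordered in `t` (already on one face), and since all one-cell marginals are `½`
  (`cornerFace_one_cell_half`) Strassen's theorem excludes any monotone coupling in `t`:
  CornerIrrelevance cannot be a Russo / Grimmett–Manolescu monotone interpolation in `t`.
-/

noncomputable section

namespace Summit.CriticalPhenomena.CardyFormulaZ2.Theorems.CornerLineDescent.Negative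

/-- A colouring of the four cells `(SW, SE, NW, NE)` of one face (`true` = black). [folklore] -/
abbrev CornerFace : Type := Bool × Bool × Bool × Bool

namespace CornerFace

/-- The face is odd (a corner / turning vertex of the domain walls) iff an odd number of its four
cells is black. [folklore] -/
def odd (σ : CornerFace) : Bool := xor σ.1 (xor σ.2.1 (xor σ.2.2.1 σ.2.2.2))

/-- Corner-fugacity weight of one face: `t` if odd, `1` if even. [folklore] -/
def weight (t : ℝ) (σ : CornerFace) : ℝ := if odd σ then t else 1

/-- Unnormalised expectation `Σ_σ t^{[odd σ]} f(σ)`. [folklore] -/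
def wsum (t : ℝ) (f : CornerFace → ℝ) : ℝ := ∑ σ : CornerFace, weight t σ * f σ

/-- Partition function of one free face. [folklore] -/
def Z (t : ℝ) : ℝ := wsum t fun _ ↦ 1

/-- Probability of a real observable of the four colours under the one-face corner-fugacity law.
[folklore] -/
def prob (t : ℝ) (f : CornerFace → ℝ) : ℝ := wsum t f / Z t

/-- Indicator of a Boolean predicate as a real function. [folklore] -/
def ind (P : CornerFace → Bool) : CornerFace → ℝ := fun σ ↦ if P σ then 1 else 0

/-- The increasing event "the main diagonal carries a black cell": `SW ∨ NE`. [folklore] -/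
def mainOr : CornerFace → Bool := fun σ ↦ σ.1 || σ.2.2.2

/-- The increasing event "the anti-diagonal is black": `SE ∧ NW`. [folklore] -/
def antiAnd : CornerFace → Bool := fun σ ↦ σ.2.1 && σ.2.2.1

/-- The increasing event "at least three of the four cells are black". [folklore] -/
def three : CornerFace → Bool := fun σ ↦
  3 ≤ (σ.1.toNat + σ.2.1.toNat + σ.2.2.1.toNat + σ.2.2.2.toNat)

/-- The increasing event "all four cells are black". [folklore] -/
def four : CornerFace → Bool := fun σ ↦ σ.1 && σ.2.1 && σ.2.2.1 && σ.2.2.2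

/-- `Z = 8 + 8t` (eight even and eight odd colourings). [folklore] -/
theorem Z_eq (t : ℝ) : Z t = 8 + 8 * t := by
  simp [Z, wsum, weight, odd, Fintype.sum_prod_type]
  ring

/-- Unnormalised moments of the two diagonal events: `Σ w·f·g = 1 + 2t`, `Σ w·f = 6 + 6t`,
`Σ w·g = 2 + 2t`. [folklore] -/
theorem diag_moments (t : ℝ) :
    wsum t (fun σ ↦ ind mainOr σ * ind antiAnd σ) = 1 + 2 * t ∧
    wsum t (ind mainOr) = 6 + 6 * t ∧ wsum t (ind antiAnd) = 2 + 2 * t := by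
  refine ⟨?_, ?_, ?_⟩ <;>
    simp [wsum, weight, odd, ind, mainOr, antiAnd, Fintype.sum_prod_type] <;> ring

/-- Unnormalised weights of `{≥ 3 black}` (`1 + 4t`) and `{4 black}` (`1`). [folklore] -/
theorem tail_moments (t : ℝ) :
    wsum t (ind three) = 1 + 4 * t ∧ wsum t (ind four) = 1 := by
  refine ⟨?_, ?_⟩ <;>
    simp [wsum, weight, odd, ind, three, four, Fintype.sum_prod_type]
  ring

/-- Unnormalised weight of `{SW black}`: `4 + 4t = Z/2`. [folklore] -/
theorem one_cell_moment (t : ℝ) : wsum t (ind fun σ ↦ σ.1) = 4 + 4 * t := by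
  simp [wsum, weight, odd, ind, Fintype.sum_prod_type]
  ring

end CornerFace

open CornerFace

/-- 3-WISE INDEPENDENCE on the corner line: for every prescribed colouring of three of the four
cells of a face the total weight of the two completions is `1 + t`, i.e. any three cells of a face
are i.i.d. fair (probability `(1+t)/(8(1+t)) = 1/8` for each pattern) for EVERY `t` — pairwise and
three-point statistics of the colour field `M(t,½)` cannot distinguish the IK point from bond-type
`t = 0` or from the i.i.d. colouring `t = 1`.  (No lever for crossings by itself: k-wise
independence with fair marginals does not pin the crossing probability of the `n × n` grid for any
fixed `k` — Benjamini, Gurel-Gurevich, Peled, arXiv:1201.3261, §4.6, Thm 19–20.) [folklore] -/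
theorem cornerFace_three_cells_uniform (t : ℝ) (a b c : Bool) :
    (weight t (a, b, c, true) + weight t (a, b, c, false) = 1 + t) ∧
    (weight t (a, b, true, c) + weight t (a, b, false, c) = 1 + t) ∧
    (weight t (a, true, b, c) + weight t (a, false, b, c) = 1 + t) ∧
    (weight t (true, a, b, c) + weight t (false, a, b, c) = 1 + t) := by
  cases a <;> cases b <;> cases c <;> simp [weight, odd] <;> ring

/-- Every single cell is black with probability `½` for every `t ≥ 0`. [folklore] -/
theorem cornerFace_one_cell_half {t : ℝ} (ht : 0 ≤ t) : prob t (ind fun σ ↦ σ.1) = 1 / 2 := by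
  simp only [prob, one_cell_moment, Z_eq]
  have hZ : (8 + 8 * t) ≠ 0 := by positivity
  field_simp
  ring

/-- NEGATIVE ASSOCIATION on one face for `0 ≤ t < 1` (so at the IK point `t = √3/2` and at the
freezing point `t = 0`): the increasing events `{SW ∨ NE black}`, `{SE ∧ NW black}` satisfy
`E[fg]·Z < E[f]·E[g]` in unnormalised form, i.e. `Cov(f,g) < 0`.  The corner-fugacity field (= the
2×2 marginal of the route's i.i.d. gauge) is NOT positively associated: no Harris–FKG inequality on
`[0,1)`. [folklore] -/
theorem cornerFace_negative_association {t : ℝ} (ht0 : 0 ≤ t) (ht1 : t < 1) :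
    wsum t (fun σ ↦ ind mainOr σ * ind antiAnd σ) * Z t <
      wsum t (ind mainOr) * wsum t (ind antiAnd) := by
  obtain ⟨h1, h2, h3⟩ := diag_moments t
  rw [h1, h2, h3, Z_eq]
  nlinarith

/-- The covariance in closed form: `Cov_t(f,g) = −(1−t)/(16(1+t))` (`= −ρ/16` with
`ρ = (1−t)/(1+t) = 1 − 2p`, the face value quoted in the route's why-might-fail note). [folklore] -/
theorem cornerFace_cov_formula {t : ℝ} (ht : 0 ≤ t) :
    prob t (fun σ ↦ ind mainOr σ * ind antiAnd σ) - prob t (ind mainOr) * prob t (ind antiAnd) =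
      -(1 - t) / (16 * (1 + t)) := by
  obtain ⟨h1, h2, h3⟩ := diag_moments t
  simp only [prob, h1, h2, h3, Z_eq]
  have h : (8 + 8 * t) ≠ 0 := by positivity
  field_simp
  ring

/-- NO STOCHASTIC ORDER ALONG THE CORNER LINE: for `0 ≤ t < t'` the increasing event
`{≥ 3 of the 4 cells black}` has probability `(1+4t)/(8(1+t))`, increasing in `t`, while the
increasing event `{all 4 black}` has probability `1/(8(1+t))`, decreasing in `t`.  Hence neither
`M(t,½) ≼ M(t',½)` nor `M(t',½) ≼ M(t,½)`, and (one-cell marginals being `½` throughout) no monotone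
coupling in `t` exists by Strassen's theorem: a Russo / Grimmett–Manolescu monotone interpolation in
`t` is unavailable for CornerIrrelevance. [folklore] -/
theorem cornerFace_no_stochastic_order {t t' : ℝ} (ht : 0 ≤ t) (htt' : t < t') :
    prob t (ind three) < prob t' (ind three) ∧ prob t' (ind four) < prob t (ind four) := by
  obtain ⟨a1, a2⟩ := tail_moments t
  obtain ⟨b1, b2⟩ := tail_moments t'
  simp only [prob, a1, a2, b1, b2, Z_eq]
  have hZ : (0 : ℝ) < 8 + 8 * t := by positivity
  have hZ' : (0 : ℝ) < 8 + 8 * t' := by linarith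
  constructor
  · rw [div_lt_div_iff₀ hZ hZ']
    nlinarith
  · rw [div_lt_div_iff₀ hZ' hZ]
    nlinarith

end Summit.CriticalPhenomena.CardyFormulaZ2.Theorems.CornerLineDescent.Negative
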